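import Mathlib
import HarnessLib
import Literature.MathematicalPhysics.QuantumLattice.KohnLuttinger
import Literature.Analysis.ValidatedNumerics.TrigLogTables
import Summits.HubbardSuperconductivity.HubbardSuperconductivity.Theorems.ChiralWindowCwKLChiralWindowMuWindow

/-!
# `TwTipContinuation` (stmt-HubbardSuperconductivity-1700) — line `kl-mechanism-datum`,
# stub `stub_b1gFilling` (the free-band filling at the level `μ₀ = -7/10`)

For the nearest-neighbour band `ε₀ = squareDispersion 1 0` (`ε₀ p = -2 (cos p₀ + cos p₁)`) the filling
is `n(μ) = 2 vol({ε₀ < μ} ∩ BZ) / (2π)²` (`kl_mu_filling_eq`).  At `μ₀ = -7/10` the occupied set is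
`{cos p₀ + cos p₁ > 7/20}` and we prove `3/5 ≤ n(-7/10) ≤ 9/10` (true value `≈ 0.7067`) with two
explicit discs, exactly as in `Theorems/ChiralWindowCwKLChiralWindowMuWindow.lean`:

* `B(0, 39/20) ⊆ {ε₀ < -7/10} ∩ BZ` (`b1gF_ball_subset_occupied`), whence
  `n ≥ (39/20)²/(2π) ≥ 3/5` (`π < 3.15`);
* `{ε₀ < -7/10} ∩ BZ ⊆ B(0, 58/25)` (`b1gF_occupied_subset_ball`), whence
  `n ≤ (58/25)²/(2π) ≤ 9/10` (`π > 3`).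

Both inclusions reduce (`cos` is even and antitone on `[0, π]`) to finitely many inequalities
between cosines of rational numbers: writing `x = |p₀|`, `y = |p₁|`, the range of `x` is cut into
cells `[a, a']`; on a cell of the inner disc `cos x ≥ cos a'` and `y < Y` (`Y² ≥ (39/20)² - a²`), so
`cos x + cos y ≥ cos a' + cos Y > 7/20` (`b1gF_inner_cell`, 20 cells, `b1gF_inner_sound`); outside the
outer disc `cos x ≤ cos a` and `y ≥ Z` (`Z² ≤ (58/25)² - a'²`), so `cos x + cos y ≤ cos a + cos Z ≤ 7/20`
(`b1gF_outer_cell`, 8 cells, `b1gF_outer_sound`).  The 28 numerical facts `cos a' + cos Y > 7/20`,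
`cos a + cos Z ≤ 7/20` are certified by the kernel (`decide +kernel`) through the tree's fixed-point
interval engine (`FI.cosSin`, `FI.mem_cosSin`, `FI.loQ_le`, `FI.le_hiQ` of
`Literature/Analysis/ValidatedNumerics`).  Folklore; no definitions.
-/

noncomputable section

namespace Summit.HubbardSuperconductivity.TwTipContinuation.KlMechanismDatum

open MeasureTheory Literature.MathematicalPhysics.QuantumLattice
open Summit.HubbardSuperconductivity.HubbardSuperconductivity.Theorems
open Literature.Analysis.ValidatedNumerics.Numerics

/-! ### Certified cosine values at rational points -/

/-- The engine's lower end point for `cos q` is a lower bound: `loQ (cosSin (ofRat q)).1 ≤ cos q`.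
[folklore] -/
theorem b1gF_loQ_le_cos (q : ℚ) : ((FI.cosSin (FI.ofRat q)).1.loQ : ℝ) ≤ Real.cos q :=
  FI.loQ_le (FI.mem_cosSin (FI.mem_ofRat q)).1

/-- The engine's upper end point for `cos q` is an upper bound: `cos q ≤ hiQ (cosSin (ofRat q)).1`.
[folklore] -/
theorem b1gF_cos_le_hiQ (q : ℚ) : Real.cos q ≤ ((FI.cosSin (FI.ofRat q)).1.hiQ : ℝ) :=
  FI.le_hiQ (FI.mem_cosSin (FI.mem_ofRat q)).1

/-! ### The inner disc `B(0, 39/20)`: one cell, and the cell decomposition -/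

/-- **One cell of the inner disc.**  If `0 ≤ a ≤ x ≤ a' ≤ 3`, `0 ≤ y`, `x² + y² < (39/20)²` and the
rational data satisfy `(39/20)² - a² ≤ Y²`, `0 ≤ Y ≤ 3` and (kernel-certified) `cos a' + cos Y > 7/20`,
then `cos x + cos y > 7/20`: indeed `cos x ≥ cos a'` and `y < Y`, `cos y ≥ cos Y`. [folklore] -/
theorem b1gF_inner_cell {a a' Y : ℚ} {x y : ℝ}
    (hc : 0 ≤ a ∧ a' ≤ 3 ∧ 0 ≤ Y ∧ Y ≤ 3 ∧ (39 / 20 : ℚ) * (39 / 20) - a * a ≤ Y * Y ∧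
      (7 / 20 : ℚ) < (FI.cosSin (FI.ofRat a')).1.loQ + (FI.cosSin (FI.ofRat Y)).1.loQ)
    (hax : (a : ℝ) ≤ x) (hxa : x ≤ a') (hy : 0 ≤ y) (hxy : x ^ 2 + y ^ 2 < (39 / 20) ^ 2) :
    7 / 20 < Real.cos x + Real.cos y := by
  obtain ⟨ha0, ha3, hY0, hY3, hY, hnum⟩ := hc
  have hpi := Real.pi_gt_three
  have ha0' : ((0 : ℚ) : ℝ) ≤ a := by exact_mod_cast ha0
  have ha3' : (a' : ℝ) ≤ ((3 : ℚ) : ℝ) := by exact_mod_cast ha3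
  have hY0' : ((0 : ℚ) : ℝ) ≤ Y := by exact_mod_cast hY0
  have hY3' : (Y : ℝ) ≤ ((3 : ℚ) : ℝ) := by exact_mod_cast hY3
  have hY' : (((39 / 20 : ℚ) * (39 / 20) - a * a : ℚ) : ℝ) ≤ ((Y * Y : ℚ) : ℝ) := by
    exact_mod_cast hY
  have hnum' : ((7 / 20 : ℚ) : ℝ) <
      (((FI.cosSin (FI.ofRat a')).1.loQ + (FI.cosSin (FI.ofRat Y)).1.loQ : ℚ) : ℝ) := by
    exact_mod_cast hnum
  push_cast at ha0' ha3' hY0' hY3' hY' hnum'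
  -- `cos x ≥ cos a'`
  have hx0 : 0 ≤ x := ha0'.trans hax
  have hcx : Real.cos a' ≤ Real.cos x :=
    Real.cos_le_cos_of_nonneg_of_le_pi hx0 (by linarith) hxa
  -- `y < Y`, so `cos y ≥ cos Y`
  have hax2 : (a : ℝ) * a ≤ x * x := mul_le_mul hax hax ha0' hx0
  have hy2 : y ^ 2 < (Y : ℝ) ^ 2 := by nlinarith
  have hyY : y < Y := (abs_lt_of_sq_lt_sq' hy2 hY0').2
  have hcy : Real.cos Y ≤ Real.cos y :=
    Real.cos_le_cos_of_nonneg_of_le_pi hy (by linarith) hyY.le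
  have h1 := b1gF_loQ_le_cos a'
  have h2 := b1gF_loQ_le_cos Y
  linarith

/-- **The inner disc, reduced to the first quadrant.**  For `x, y ≥ 0` with `x² + y² < (39/20)²`,
`cos x + cos y > 7/20`: `x` lies in one of 20 cells `[a, a']` covering `[0, 39/20]`, each certified by
`b1gF_inner_cell` (the numerical inequality is decided by the kernel). [folklore] -/
theorem b1gF_inner_sound {x y : ℝ} (hx : 0 ≤ x) (hy : 0 ≤ y)
    (hxy : x ^ 2 + y ^ 2 < (39 / 20) ^ 2) : 7 / 20 < Real.cos x + Real.cos y := by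
  have hx0 : ((0 : ℚ) : ℝ) ≤ x := by exact_mod_cast hx
  have hxr : x ≤ ((39 / 20 : ℚ) : ℝ) := by
    have h : x ^ 2 < (39 / 20) ^ 2 := by nlinarith [sq_nonneg y]
    have := (abs_lt_of_sq_lt_sq' h (by norm_num)).2
    push_cast
    exact this.le
  by_cases h1 : x ≤ ((153/200 : ℚ) : ℝ)
  · exact b1gF_inner_cell (a := 0) (a' := 153/200) (Y := 39/20) (by decide +kernel) hx0 h1 hy hxy
  by_cases h2 : x ≤ ((24/25 : ℚ) : ℝ)
  · exact b1gF_inner_cell (a := 153/200) (a' := 24/25) (Y := 17937/10000) (by decide +kernel)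
      (not_le.1 h1).le h2 hy hxy
  by_cases h3 : x ≤ ((107/100 : ℚ) : ℝ)
  · exact b1gF_inner_cell (a := 24/25) (a' := 107/100) (Y := 8487/5000) (by decide +kernel)
      (not_le.1 h2).le h3 hy hxy
  by_cases h4 : x ≤ ((229/200 : ℚ) : ℝ)
  · exact b1gF_inner_cell (a := 107/100) (a' := 229/200) (Y := 16303/10000) (by decide +kernel)
      (not_le.1 h3).le h4 hy hxy
  by_cases h5 : x ≤ ((6/5 : ℚ) : ℝ)
  · exact b1gF_inner_cell (a := 229/200) (a' := 6/5) (Y := 3157/2000) (by decide +kernel)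
      (not_le.1 h4).le h5 hy hxy
  by_cases h6 : x ≤ ((249/200 : ℚ) : ℝ)
  · exact b1gF_inner_cell (a := 6/5) (a' := 249/200) (Y := 15371/10000) (by decide +kernel)
      (not_le.1 h5).le h6 hy hxy
  by_cases h7 : x ≤ ((257/200 : ℚ) : ℝ)
  · exact b1gF_inner_cell (a := 249/200) (a' := 257/200) (Y := 15009/10000) (by decide +kernel)
      (not_le.1 h6).le h7 hy hxy
  by_cases h8 : x ≤ ((33/25 : ℚ) : ℝ)
  · exact b1gF_inner_cell (a := 257/200) (a' := 33/25) (Y := 3667/2500) (by decide +kernel)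
      (not_le.1 h7).le h8 hy hxy
  by_cases h9 : x ≤ ((27/20 : ℚ) : ℝ)
  · exact b1gF_inner_cell (a := 33/25) (a' := 27/20) (Y := 7177/5000) (by decide +kernel)
      (not_le.1 h8).le h9 hy hxy
  by_cases h10 : x ≤ ((69/50 : ℚ) : ℝ)
  · exact b1gF_inner_cell (a := 27/20) (a' := 69/50) (Y := 1759/1250) (by decide +kernel)
      (not_le.1 h9).le h10 hy hxy
  by_cases h11 : x ≤ ((141/100 : ℚ) : ℝ)
  · exact b1gF_inner_cell (a := 69/50) (a' := 141/100) (Y := 6889/5000) (by decide +kernel)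
      (not_le.1 h10).le h11 hy hxy
  by_cases h12 : x ≤ ((36/25 : ℚ) : ℝ)
  · exact b1gF_inner_cell (a := 141/100) (a' := 36/25) (Y := 1347/1000) (by decide +kernel)
      (not_le.1 h11).le h12 hy hxy
  by_cases h13 : x ≤ ((147/100 : ℚ) : ℝ)
  · exact b1gF_inner_cell (a := 36/25) (a' := 147/100) (Y := 13149/10000) (by decide +kernel)
      (not_le.1 h12).le h13 hy hxy
  by_cases h14 : x ≤ ((301/200 : ℚ) : ℝ)
  · exact b1gF_inner_cell (a := 147/100) (a' := 301/200) (Y := 12813/10000) (by decide +kernel)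
      (not_le.1 h13).le h14 hy hxy
  by_cases h15 : x ≤ ((309/200 : ℚ) : ℝ)
  · exact b1gF_inner_cell (a := 301/200) (a' := 309/200) (Y := 31/25) (by decide +kernel)
      (not_le.1 h14).le h15 hy hxy
  by_cases h16 : x ≤ ((159/100 : ℚ) : ℝ)
  · exact b1gF_inner_cell (a := 309/200) (a' := 159/100) (Y := 5949/5000) (by decide +kernel)
      (not_le.1 h15).le h16 hy hxy
  by_cases h17 : x ≤ ((329/200 : ℚ) : ℝ)
  · exact b1gF_inner_cell (a := 159/100) (a' := 329/200) (Y := 11289/10000) (by decide +kernel)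
      (not_le.1 h16).le h17 hy hxy
  by_cases h18 : x ≤ ((43/25 : ℚ) : ℝ)
  · exact b1gF_inner_cell (a := 329/200) (a' := 43/25) (Y := 1309/1250) (by decide +kernel)
      (not_le.1 h17).le h18 hy hxy
  by_cases h19 : x ≤ ((183/100 : ℚ) : ℝ)
  · exact b1gF_inner_cell (a := 43/25) (a' := 183/100) (Y := 2297/2500) (by decide +kernel)
      (not_le.1 h18).le h19 hy hxy
  exact b1gF_inner_cell (a := 183/100) (a' := 39/20) (Y := 1347/2000) (by decide +kernel)
    (not_le.1 h19).le hxr hy hxy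

/-! ### The outer disc `B(0, 58/25)`: one cell, and the cell decomposition -/

/-- **One cell of the outer disc.**  If `0 ≤ a ≤ x ≤ a'`, `x ≤ π`, `0 ≤ y ≤ π`, `x² + y² ≥ (58/25)²`
and the rational data satisfy `0 ≤ Z`, `Z = 0 ∨ Z² ≤ (58/25)² - a'²` and (kernel-certified)
`cos a + cos Z ≤ 7/20`, then `cos x + cos y ≤ 7/20`: indeed `cos x ≤ cos a` and `y ≥ Z`,
`cos y ≤ cos Z`. [folklore] -/
theorem b1gF_outer_cell {a a' Z : ℚ} {x y : ℝ}
    (hc : 0 ≤ a ∧ 0 ≤ Z ∧ (Z ≤ 0 ∨ Z * Z ≤ (58 / 25 : ℚ) * (58 / 25) - a' * a') ∧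
      (FI.cosSin (FI.ofRat a)).1.hiQ + (FI.cosSin (FI.ofRat Z)).1.hiQ ≤ (7 / 20 : ℚ))
    (hax : (a : ℝ) ≤ x) (hxa : x ≤ a') (hxπ : x ≤ Real.pi) (hy : 0 ≤ y) (hyπ : y ≤ Real.pi)
    (hxy : (58 / 25 : ℝ) ^ 2 ≤ x ^ 2 + y ^ 2) :
    Real.cos x + Real.cos y ≤ 7 / 20 := by
  obtain ⟨ha0, hZ0, hZ, hnum⟩ := hc
  have ha0' : ((0 : ℚ) : ℝ) ≤ a := by exact_mod_cast ha0
  have hZ0' : ((0 : ℚ) : ℝ) ≤ Z := by exact_mod_cast hZ0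
  have hnum' : (((FI.cosSin (FI.ofRat a)).1.hiQ + (FI.cosSin (FI.ofRat Z)).1.hiQ : ℚ) : ℝ) ≤
      ((7 / 20 : ℚ) : ℝ) := by
    exact_mod_cast hnum
  push_cast at ha0' hZ0' hnum'
  -- `cos x ≤ cos a`
  have hcx : Real.cos x ≤ Real.cos a := Real.cos_le_cos_of_nonneg_of_le_pi ha0' hxπ hax
  -- `Z ≤ y`, so `cos y ≤ cos Z`
  have hZy : (Z : ℝ) ≤ y := by
    rcases hZ with hZ | hZ
    · have hZ' : (Z : ℝ) ≤ ((0 : ℚ) : ℝ) := by exact_mod_cast hZ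
      push_cast at hZ'
      linarith
    · have hZ' : ((Z * Z : ℚ) : ℝ) ≤ (((58 / 25 : ℚ) * (58 / 25) - a' * a' : ℚ) : ℝ) := by
        exact_mod_cast hZ
      push_cast at hZ'
      have hx0 : 0 ≤ x := ha0'.trans hax
      have hxa2 : x * x ≤ (a' : ℝ) * a' := mul_le_mul hxa hxa hx0 (hx0.trans hxa)
      have hZy2 : (Z : ℝ) ^ 2 ≤ y ^ 2 := by nlinarith
      exact (abs_le_of_sq_le_sq' hZy2 hy).2
  have hcy : Real.cos y ≤ Real.cos Z := Real.cos_le_cos_of_nonneg_of_le_pi hZ0' hyπ hZy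
  have h1 := b1gF_cos_le_hiQ a
  have h2 := b1gF_cos_le_hiQ Z
  linarith

/-- **The outer disc, reduced to the first quadrant.**  For `x, y ∈ [0, π]` with
`cos x + cos y > 7/20` one has `x² + y² < (58/25)²`: otherwise `x` lies in one of 8 cells `[a, a']`
covering `[0, 4] ⊇ [0, π]`, each certified by `b1gF_outer_cell` (the last cell `[2279/1000, 4]` uses
only `cos y ≤ 1`, i.e. `Z = 0`). [folklore] -/
theorem b1gF_outer_sound {x y : ℝ} (hx : 0 ≤ x) (hxπ : x ≤ Real.pi) (hy : 0 ≤ y)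
    (hyπ : y ≤ Real.pi) (hsum : 7 / 20 < Real.cos x + Real.cos y) :
    x ^ 2 + y ^ 2 < (58 / 25) ^ 2 := by
  by_contra hR
  push Not at hR
  have hx0 : ((0 : ℚ) : ℝ) ≤ x := by exact_mod_cast hx
  have hx4 : x ≤ ((4 : ℚ) : ℝ) := by
    have := Real.pi_le_four
    push_cast
    linarith
  have key : Real.cos x + Real.cos y ≤ 7 / 20 := by
    by_cases h1 : x ≤ ((87/200 : ℚ) : ℝ)
    · exact b1gF_outer_cell (a := 0) (a' := 87/200) (Z := 5697/2500) (by decide +kernel)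
        hx0 h1 hxπ hy hyπ hR
    by_cases h2 : x ≤ ((21/25 : ℚ) : ℝ)
    · exact b1gF_outer_cell (a := 87/200) (a' := 21/25) (Z := 173/80) (by decide +kernel)
        (not_le.1 h1).le h2 hxπ hy hyπ hR
    by_cases h3 : x ≤ ((267/200 : ℚ) : ℝ)
    · exact b1gF_outer_cell (a := 21/25) (a' := 267/200) (Z := 9487/5000) (by decide +kernel)
        (not_le.1 h2).le h3 hxπ hy hyπ hR
    by_cases h4 : x ≤ ((361/200 : ℚ) : ℝ)
    · exact b1gF_outer_cell (a := 267/200) (a' := 361/200) (Z := 583/400) (by decide +kernel)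
        (not_le.1 h3).le h4 hxπ hy hyπ hR
    by_cases h5 : x ≤ ((423/200 : ℚ) : ℝ)
    · exact b1gF_outer_cell (a := 361/200) (a' := 423/200) (Z := 1907/2000) (by decide +kernel)
        (not_le.1 h4).le h5 hxπ hy hyπ hR
    by_cases h6 : x ≤ ((113/50 : ℚ) : ℝ)
    · exact b1gF_outer_cell (a := 423/200) (a' := 113/50) (Z := 2621/5000) (by decide +kernel)
        (not_le.1 h5).le h6 hxπ hy hyπ hR
    by_cases h7 : x ≤ ((2279/1000 : ℚ) : ℝ)
    · exact b1gF_outer_cell (a := 113/50) (a' := 2279/1000) (Z := 2171/5000) (by decide +kernel)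
        (not_le.1 h6).le h7 hxπ hy hyπ hR
    exact b1gF_outer_cell (a := 2279/1000) (a' := 4) (Z := 0) (by decide +kernel)
      (not_le.1 h7).le hx4 hxπ hy hyπ hR
  linarith

/-! ### The two inclusions -/

/-- The disc of radius `39/20` lies in the Brillouin zone and strictly below the energy `-7/10`:
there `cos p₀ + cos p₁ > 7/20` (`b1gF_inner_sound` at `|p₀|, |p₁|`) and `|pᵢ| < 39/20 < π`.
[folklore] -/
theorem b1gF_ball_subset_occupied :
    Metric.ball (0 : Momentum) (39 / 20) ⊆
      {p : Momentum | squareDispersion 1 0 p < -7 / 10} ∩ brillouinZone := by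
  intro p hp
  rw [EuclideanSpace.ball_zero_eq _ (by norm_num), Set.mem_setOf_eq, Fin.sum_univ_two] at hp
  have hkey : 7 / 20 < Real.cos (p 0) + Real.cos (p 1) := by
    rw [← Real.cos_abs (p 0), ← Real.cos_abs (p 1)]
    exact b1gF_inner_sound (abs_nonneg _) (abs_nonneg _) (by rw [sq_abs, sq_abs]; exact hp)
  refine ⟨?_, ?_⟩
  · simp only [Set.mem_setOf_eq, squareDispersion, mul_zero, zero_mul, sub_zero, mul_one]
    linarith
  · show ∀ i, p i ∈ Set.Ico (-Real.pi) Real.pi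
    have hpi := Real.pi_gt_three
    have key : ∀ x : ℝ, x ^ 2 < Real.pi ^ 2 → x ∈ Set.Ico (-Real.pi) Real.pi := fun x hx => by
      have := abs_lt_of_sq_lt_sq' hx Real.pi_pos.le
      exact ⟨this.1.le, this.2⟩
    refine Fin.forall_fin_two.2 ⟨key _ ?_, key _ ?_⟩
    · nlinarith [sq_nonneg (p 1)]
    · nlinarith [sq_nonneg (p 0)]

/-- Below the energy `-7/10` the occupied momenta of the Brillouin zone lie in the disc of radius
`58/25`: `cos p₀ + cos p₁ > 7/20` with `|pᵢ| ≤ π` forces `p₀² + p₁² < (58/25)²` (`b1gF_outer_sound`).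
[folklore] -/
theorem b1gF_occupied_subset_ball :
    {p : Momentum | squareDispersion 1 0 p < -7 / 10} ∩ brillouinZone ⊆
      Metric.ball (0 : Momentum) (58 / 25) := by
  intro p hp
  obtain ⟨hp1, hp2⟩ := hp
  simp only [Set.mem_setOf_eq, squareDispersion, mul_zero, zero_mul, sub_zero, mul_one] at hp1
  have hsum : 7 / 20 < Real.cos (p 0) + Real.cos (p 1) := by linarith
  have habs : ∀ i, |p i| ≤ Real.pi := fun i => by
    have := hp2 i
    rw [abs_le]
    exact ⟨this.1, this.2.le⟩
  rw [← Real.cos_abs (p 0), ← Real.cos_abs (p 1)] at hsum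
  have h := b1gF_outer_sound (abs_nonneg _) (habs 0) (abs_nonneg _) (habs 1) hsum
  rw [sq_abs, sq_abs] at h
  rw [EuclideanSpace.ball_zero_eq _ (by norm_num), Set.mem_setOf_eq, Fin.sum_univ_two]
  exact h

/-! ### The stub -/

/-- **(F) The filling at `μ₀ = -7/10`.**  `3/5 ≤ n(-7/10) ≤ 9/10` for the free band
`ε₀ = -2(cos k₀ + cos k₁)`: the occupied set `{cos k₀ + cos k₁ > 7/20} ∩ BZ` contains the disc of
radius `39/20` and is contained in the disc of radius `58/25`, whence
`n = 2·area/(2π)² ∈ [(39/20)²/(2π), (58/25)²/(2π)] ⊂ [3/5, 9/10]` (`3 < π < 3.15`); pattern of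
`kl_mu_filling_gt` / `kl_mu_filling_lt_half` in `Theorems/ChiralWindowCwKLChiralWindowMuWindow.lean`.
[folklore] -/
theorem stub_b1gFilling :
    3 / 5 ≤ KohnLuttinger.filling (squareDispersion 1 0) (-7 / 10) ∧
      KohnLuttinger.filling (squareDispersion 1 0) (-7 / 10) ≤ 9 / 10 := by
  rw [kl_mu_filling_eq]
  have hball : ∀ r : ℝ, 0 ≤ r →
      (volume (Metric.ball (0 : Momentum) r)).toReal = r ^ 2 * Real.pi := by
    intro r hr
    rw [EuclideanSpace.volume_ball_fin_two, ENNReal.toReal_mul, ENNReal.toReal_pow,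
      ENNReal.toReal_ofReal hr, ENNReal.toReal_ofReal Real.pi_pos.le]
  have hlo : (39 / 20) ^ 2 * Real.pi ≤
      (volume ({p : Momentum | squareDispersion 1 0 p < -7 / 10} ∩ brillouinZone)).toReal := by
    rw [← hball _ (by norm_num)]
    exact ENNReal.toReal_mono (kl_mu_volume_occupied_lt_top _).ne
      (measure_mono b1gF_ball_subset_occupied)
  have hhi : (volume ({p : Momentum | squareDispersion 1 0 p < -7 / 10} ∩ brillouinZone)).toReal ≤
      (58 / 25) ^ 2 * Real.pi := by
    rw [← hball _ (by norm_num)]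
    exact ENNReal.toReal_mono measure_ball_lt_top.ne (measure_mono b1gF_occupied_subset_ball)
  have hpi3 := Real.pi_gt_three
  have hpi := Real.pi_lt_d2
  have hpos : (0 : ℝ) < (2 * Real.pi) ^ 2 := by positivity
  constructor
  · rw [le_div_iff₀ hpos]
    nlinarith
  · rw [div_le_iff₀ hpos]
    nlinarith

end Summit.HubbardSuperconductivity.TwTipContinuation.KlMechanismDatum

end
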